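import Literature.Algebra.Homology.ContCohomologyInnerDegreeTwo
import HarnessLib

/-!
# Inner automorphisms act trivially on continuous cohomology in degree one (general coefficients)

Generic infrastructure over Mathlib's `continuousCohomology` (homogeneous continuous cochains).
For a LOCALLY COMPACT topological group `G`, a topological `k[G]`-module `X : TopRep k G` and
`τ ∈ G`, the endomorphism of `H¹(G, X)` induced by the compatible pair
`(g ↦ τ⁻¹ g τ, m ↦ τ • m)` is the IDENTITY (`map_one_eq_id_of_inner`).  Source of the statement:
J.-P. Serre, *Corps locaux* VII §5 Prop. 3 / *Cohomologie galoisienne* I §2.4–2.5 (the conjugation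
action of `G` on `H^q(G, A)` is trivial) [cite: SerreGaloisCohomology1997, I §2.5].  The tree holds
the degree-ONE case for DISCRETE coefficients (`Literature.NumberTheory.EllipticCurves.map_conj_one_eq_id`,
`Sha.lean`, no local compactness) and the degree-TWO case for arbitrary topological coefficients
(`ContinuousCohomology.map_two_eq_id_of_inner`, `ContCohomologyInnerDegreeTwo.lean`, local compactness);
this file is the missing corner — degree one, ARBITRARY topological coefficients, `G` locally compact —
by the explicit homotopy on homogeneous cochains: for a `1`-cocycle `F`, `F(xτ, yτ) − F(x, y) = h(y) − h(x)`
with `h(a) := F(a, aτ)` (`exists_homotopyCochain_one`, `prism_one`; continuity of `h` uses local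
compactness of `G` through the continuity of evaluation `C(G, X) × G → X`).  All declarations are
theorems (no data is introduced): the pair `(φ, u)` is taken as a parameter with the hypotheses
`φ g = τ⁻¹ g τ`, `u m = τ • m`, exactly as in the degree-two file.

Consumer (cell abc-iut, layer L4): with `G := G_k` profinite (hence locally compact) and `X := μ_Ẑ(G_k)`
(the group-theoretic cyclotome, NOT discrete) this is the inner-automorphism leg of the functoriality of
[AbsTopIII] Cor. 1.10 (i)(b) «with respect to arbitrary injective open homomorphisms» (an injective open
`β : H ↪ G_k` is `Inn(g) ∘ res ∘ iso`, `OpenInjectionFactorsThroughRestriction.lean`).  Classical; nothing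
here bears on the disputed parts of IUT.
-/

noncomputable section

open CategoryTheory TopRep ContRepresentation Topology

namespace ContinuousCohomology

universe u v w

variable {k : Type u} [Ring k] [TopologicalSpace k]
variable {G : Type v} [Group G] [TopologicalSpace G] [IsTopologicalGroup G]
variable (X : TopRep.{max v w} k G)

/-! ### Formulas -/

/-- A compatible pair `(φ, u)` acts on homogeneous `1`-cochains by
`F ↦ ((x, y) ↦ u (F (φ x) (φ y)))`. [cite: SerreGaloisCohomology1997, I §2.4] -/
theorem cochainsMap_f_one_pair_apply {H : Type v} [Group H] [TopologicalSpace H] [IsTopologicalGroup H]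
    (φ : H →ₜ* G) {Y : TopRep.{max v w} k H} (u : res (φ : H →* G) X ⟶ Y)
    (σ : (homogeneousCochains X).X 1) (x y : H) :
    (((cochainsMap φ u).f 1).hom σ).1 x y = u.hom (σ.1 (φ x) (φ y)) := rfl

/-- Homogeneity of a `1`-cochain, evaluated: `g • F (g⁻¹ x) (g⁻¹ y) = F x y`.
(private twin of `Literature.NumberTheory.EllipticCurves.coe_invariants_two_apply`, kept local to avoid the
elliptic-curve import). [cite: SerreGaloisCohomology1997, I §2.2] -/
private theorem invariant_two_apply (F : (homogeneousCochains X).X 1) (g x y : G) :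
    X.ρ g (F.1 (g⁻¹ * x) (g⁻¹ * y)) = F.1 x y :=
  DFunLike.congr_fun (DFunLike.congr_fun (F.2 g) x) y

/-- The `1`-cocycle identity, evaluated: `F y z − (F x z − F x y) = 0` for `d¹ F = 0`.
[cite: SerreGaloisCohomology1997, I §2.2] -/
theorem cocycle_one_eq (F : (homogeneousCochains X).X 1)
    (hF : ((homogeneousCochains X).d 1 2).hom F = 0) (x y z : G) :
    F.1 y z - (F.1 x z - F.1 x y) = 0 := by
  have h := congr($(hF).1 x y z)
  rw [homogeneousCochains.d_apply] at h
  exact h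

/-! ### The degree-one homotopy -/

/-- **The homotopy cochain exists** (as an invariant continuous `0`-cochain): for `G` locally
compact, every homogeneous `1`-cochain `F` and every `τ ∈ G`, there is an invariant `0`-cochain `h`
with `h a = F a (a τ)`. [cite: SerreGaloisCohomology1997, I §2.5] -/
theorem exists_homotopyCochain_one [LocallyCompactSpace G] (τ : G)
    (F : (homogeneousCochains X).X 1) :
    ∃ h : (homogeneousCochains X).X 0, ∀ a : G, h.1 a = F.1 a (a * τ) := by
  -- `a ↦ F a (aτ)` : evaluation `C(G, X) × G → X` is continuous (locally compact `G`)
  have hev : Continuous fun p : C(G, X) × G => p.1 p.2 := continuous_eval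
  let h₀ : C(G, X) :=
    ⟨fun a => F.1 a (a * τ), hev.comp (F.1.continuous.prodMk (continuous_mul_const τ))⟩
  refine ⟨⟨h₀, fun g => ?_⟩, fun a => rfl⟩
  ext a
  change X.ρ g (F.1 (g⁻¹ * a) (g⁻¹ * a * τ)) = F.1 a (a * τ)
  rw [mul_assoc, invariant_two_apply]

/-- **The prism identity in degree one**: for a `1`-COCYCLE `F` and the homotopy cochain `h` of
`exists_homotopyCochain_one`, `F (xτ) (yτ) = F x y + (d h)(x)(y) = F x y + (h y − h x)`.
[cite: SerreGaloisCohomology1997, I §2.5] -/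
theorem prism_one (τ : G) (F : (homogeneousCochains X).X 1)
    (hF : ((homogeneousCochains X).d 1 2).hom F = 0) (h : (homogeneousCochains X).X 0)
    (hh : ∀ a : G, h.1 a = F.1 a (a * τ)) (x y : G) :
    F.1 (x * τ) (y * τ) = F.1 x y + (h.1 y - h.1 x) := by
  rw [hh, hh]
  have h1 := cocycle_one_eq X F hF x (x * τ) (y * τ)
  have h2 := cocycle_one_eq X F hF x y (y * τ)
  rw [← sub_eq_zero]
  have key : F.1 (x * τ) (y * τ) - (F.1 x y + (F.1 y (y * τ) - F.1 x (x * τ))) =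
      (F.1 (x * τ) (y * τ) - (F.1 x (y * τ) - F.1 x (x * τ))) -
        (F.1 y (y * τ) - (F.1 x (y * τ) - F.1 x y)) := by
    abel
  rw [key, h1, h2, sub_zero]

/-! ### The theorem -/

/-- On `1`-cocycles, an inner compatible pair `(φ = τ⁻¹(·)τ, u = τ•)` acts as
`z ↦ z + d(h)` for the homotopy cochain `h`. [cite: SerreGaloisCohomology1997, I §2.5] -/
theorem cocyclesMap_inner_one [LocallyCompactSpace G] (τ : G) (φ : G →ₜ* G)
    (hφ : ∀ g, φ g = τ⁻¹ * g * τ) (u : res (φ : G →* G) X ⟶ X) (hu : ∀ m, u.hom m = X.ρ τ m)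
    (z : (homogeneousCochains X).cycles 1) :
    ∃ h : (homogeneousCochains X).X 0,
      (cocyclesMap φ u 1).hom z = z + ((homogeneousCochains X).toCycles 0 1).hom h := by
  have hF : ((homogeneousCochains X).d 1 2).hom (((homogeneousCochains X).iCycles 1).hom z) = 0 := by
    have e3 := congrArg (fun f => f.hom z) ((homogeneousCochains X).iCycles_d 1 2)
    simpa only [TopModuleCat.hom_comp, ContinuousLinearMap.coe_comp, Function.comp_apply,
      TopModuleCat.hom_zero, zero_apply] using e3
  obtain ⟨h, hh⟩ := exists_homotopyCochain_one X τ (((homogeneousCochains X).iCycles 1).hom z)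
  refine ⟨h, cocycles_ext' X 1 ?_⟩
  have e1 := congrArg (fun f => f.hom z) (HomologicalComplex.cyclesMap_i (cochainsMap φ u) 1)
  have e2 := congrArg (fun f => f.hom h) ((homogeneousCochains X).toCycles_i 0 1)
  simp only [TopModuleCat.hom_comp, ContinuousLinearMap.coe_comp, Function.comp_apply] at e1 e2
  change ((homogeneousCochains X).iCycles 1).hom
      ((HomologicalComplex.cyclesMap (cochainsMap φ u) 1).hom z) = _
  rw [map_add, e1, e2]
  -- now a statement about cochains: `(ψ.f 1) F = F + d h`
  apply Subtype.ext
  -- the sum in `C¹(G, X)` is computed in the invariant submodule: unfold it to the ambient sum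
  change (((cochainsMap φ u).f 1).hom (((homogeneousCochains X).iCycles 1).hom z)).1 =
    (((homogeneousCochains X).iCycles 1).hom z).1 + (((homogeneousCochains X).d 0 1).hom h).1
  refine Eq.trans ?_ (congrArg
    (fun Φ => (((homogeneousCochains X).iCycles 1).hom z).1 + Φ) (homogeneousCochains.d_apply X 0 h)).symm
  ext x y
  rw [cochainsMap_f_one_pair_apply, ContinuousMap.add_apply, ContinuousMap.add_apply, hu, hφ, hφ]
  have e4 : X.ρ τ ((((homogeneousCochains X).iCycles 1).hom z).1 (τ⁻¹ * x * τ) (τ⁻¹ * y * τ)) =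
      (((homogeneousCochains X).iCycles 1).hom z).1 (x * τ) (y * τ) := by
    simpa only [mul_assoc] using
      invariant_two_apply X (((homogeneousCochains X).iCycles 1).hom z) τ (x * τ) (y * τ)
  rw [e4, prism_one X τ _ hF h hh x y]
  rfl

/-- **Inner automorphisms act trivially on `H¹` (arbitrary topological coefficients).**  For a locally
compact topological group `G`, a topological `k[G]`-module `X` and `τ ∈ G`, the endomorphism of `H¹(G, X)`
(Mathlib continuous cohomology) induced by any compatible pair `(φ, u)` with `φ g = τ⁻¹ g τ` and
`u m = τ • m` is the identity. [cite: SerreGaloisCohomology1997, I §2.5] -/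
theorem map_one_eq_id_of_inner [LocallyCompactSpace G] (τ : G) (φ : G →ₜ* G)
    (hφ : ∀ g, φ g = τ⁻¹ * g * τ) (u : res (φ : G →* G) X ⟶ X) (hu : ∀ m, u.hom m = X.ρ τ m) :
    ContinuousCohomology.map φ u 1 = 𝟙 _ := by
  rw [← cancel_epi (ContinuousCohomology.π X 1), ContinuousCohomology.π_map, Category.comp_id]
  refine ConcreteCategory.hom_ext _ _ fun z => ?_
  change ((homogeneousCochains X).homologyπ 1).hom ((cocyclesMap φ u 1).hom z) =
    ((homogeneousCochains X).homologyπ 1).hom z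
  obtain ⟨h, hz⟩ := cocyclesMap_inner_one X τ φ hφ u hu z
  rw [hz, map_add]
  have e4 := congrArg (fun f => f.hom h) ((homogeneousCochains X).toCycles_comp_homologyπ 0 1)
  simp only [TopModuleCat.hom_comp, ContinuousLinearMap.coe_comp, Function.comp_apply,
    TopModuleCat.hom_zero, zero_apply] at e4
  rw [e4, add_zero]

end ContinuousCohomology
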